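import Literature.AlgebraicGeometry.ModuliOfAbelianVarieties.SiegelModuliInterpretation
import Literature.AlgebraicGeometry.ModuliOfAbelianVarieties.SiegelAdelicMarkingExists
import Literature.AlgebraicGeometry.ModuliOfAbelianVarieties.SiegelModuliModel
import Literature.NumberTheory.ComplexMultiplication.ReflexNormFinitePartBridge
import Literature.NumberTheory.ComplexMultiplication.CMTypeUniformizationExists
import HarnessLib
/-!
# RECEPTACLE of the Mumford line under crux HDel (stmt-HodgeConjecture-24835) — would-be
`Summits/HodgeConjecture/CorCM/HypDel/MumfordModuliReceptacle.lean` (B-plan1 g6 draft R4 = R2 + `siegelS1_of_cmConjugationIsogenyAll`, 2026-08-28; REF1 (N5) route (a) + (N1) guards; §2 = second layer under (C) from B-p09 J-M3a-δ v2 — (α)/(α∀) are PROVED in B-p09's `Theorems/MumfordRouteXiAssembly.lean`, (β) is B-p21's R60-53)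

NOTHING IS ASSERTED: three closed `Prop`s — (U) `MarkingTransport`, (C) `CMConjugationIsogeny`, (C∀) `CMConjugationIsogenyAll` — and the
kernel-checked head `cmConjugationIsogenyAll_of` · `cmConjugationIsogeny_of_all` · `isCanonical_of_isModuli` ([MilISV] Prop. 14.12 as a
theorem modulo the CM input) · `siegelS1_of_mumford : deligne1971_siegelModuliOnPoints → MarkingTransport → CMConjugationIsogeny → SiegelS1`
(0 `sorry`, 0 facts).  Importable by BOTH the registry (`Cruxes/HDel/Lines/F1ExtHodgeType.lean` v4.8: `stub_markingTransport : MumfordModuli.MarkingTransport`,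
`stub_cmConjugationIsogeny : MumfordModuli.CMConjugationIsogeny`, `stub_mumford : deligne1971_siegelModuliOnPoints`,
`stub_S1 := MumfordModuli.siegelS1_of_mumford stub_mumford stub_markingTransport stub_cmConjugationIsogeny`) and by the Theorems closers
(B-p01's (U) closer; the future (C) closer / B-p09's J-M3a-δ assembly targeting `CMConjugationIsogenyAll` by name) — no import cycle.
Imports when filed: `…ModuliOfAbelianVarieties.SiegelModuliInterpretation`, `…SiegelAdelicMarkingExists`, `…SiegelModuliModel` (B-typ04 T1′ package) + HarnessLib.

WHY THIS LINE.  #60 `SiegelS1` (canonical model WITH reciprocity at CM points, [Del71] 4.21 / [MilISV] 14.12) is fan A's only remaining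
mover under `hDel`; print proves it from the reciprocity-free moduli interpretation of Mumford's `ℚ`-scheme ([MFK94] 7.9, [Del71] 4.16–4.21 —
the named fact `deligne1971_siegelModuliOnPoints`) plus the main theorem of complex multiplication ([MilISV] Thm. 11.2, [Shimura1998] Thm. 18.6;
«for more general special points it also follows …, but not quite so immediately», [MilISV] p. 125 — that is (C), CM by an order of a CM ALGEBRA).
(U) isolates the arbitrary-chart bookkeeping (two markings of one point differ by a homomorphism) so that (C) may be proved for ONE convenient
marking per point.  HC_CM is proved only modulo the 7 printed citations until rung 0 closes. -/

noncomputable section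


namespace Summit.HodgeConjecture.CorCM.HypDel.MumfordModuli

open Matrix NumberField IsDedekindDomain CategoryTheory
open Literature.AlgebraicGeometry.ModuliOfAbelianVarieties
open Literature.AlgebraicGeometry.Motives (AbelianVariety AlgPoints CMType)
open Literature.NumberTheory.ComplexMultiplication (traceField)
open Literature.AlgebraicGeometry.ShimuraVarieties (UnitaryCanonicalModel.IsArtinCorrespondent)

/-- **(U) MARKING TRANSPORT (provable, S–M, CM-free): two markings of the same point are intertwined by a homomorphism.**
For markings `m` of `A` and `m₂` of `A₂` by the same `[J, a]` there is `e : A ⟶ A₂` with `e(u(v)) = u₂(v)` for every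
`v ∈ V = ℚ^{2g}` (the `ℂ`-linear `Ψ₂ ∘ (γ₂⁻¹γ) ∘ Ψ⁻¹` carries `Ψ(ℤ^{2g})` onto `Ψ₂(ℤ^{2g})` since `γℤ^{2g} = Λ_a = γ₂ℤ^{2g}`;
GAGA ★ `AbelianVariety.exists_hom_of_mdifferentiable_complexTorus`).
[cite: LangeBirkenhake1992, Ch. 1 Prop. 1.2.1 and Ch. 2 Cor. 2.1.17] [cite: Milne2005ShimuraVarieties, §6 Thm. 6.11 p. 74] -/
def MarkingTransport : Prop :=
  ∀ (g : ℕ) (δ : Fin g → ℕ) (J : C0pm δ) (a : gspFinAdelic δ) (A A₂ : AbelianVariety ℂ)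
    (m : SiegelAdelicMarking J a A) (m₂ : SiegelAdelicMarking J a A₂),
    ∃ e : A ⟶ A₂, ∀ v : Fin g ⊕ Fin g → ℚ, AlgPoints.map e.hom.hom.hom (m.r v) = m₂.r v

/-- **(C) THE CM CONJUGATION ISOGENY for SOME marked models (provable, L; Shimura–Taniyama / main theorem of CM in isogeny
form: [Del71] 4.19, [MilISV] Thm. 11.2 «`α(N_Φ(s)·x) = σx`», [Shimura1998] Thm. 18.6).**  At a CM special pair `(c, J, Φ)`,
for `E ⊇ E(Kᵢ, Φᵢ)`, `σ ∈ Aut(ℂ/E)` and `s ∈ 𝔸_{E,f}^×` Artin-correspondent, `r ∈ GSp_δ(𝔸_f)` with matrix `r(s) =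
c.cmRecipMatrix Φ E s` (Milne's normalisation, no inverse: ★ R60-35), and every `a`: there EXIST marked models `A` of
`[J, a]`, `A′` of `[J, r·a]` and `f : σA ⟶ A′` with `f((u v)^σ) = u′(w)` whenever `a⁻¹v ≡ (ra)⁻¹w (mod ẑ^{2g})`.
The prover chooses the models (e.g. an isogenous image of `⨁ᵢ ℂ^{Φᵢ}/Φᵢ(𝔞ᵢ)`, ★ R60-37/R60-37b transport).
[cite: Deligne1971TravauxShimura, 4.19 p. 151] [cite: Milne2005ShimuraVarieties, §11 Thm. 11.2 p. 108, §14 Prop. 14.12 p. 125]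
[cite: Shimura1998, §18.6 Thm. 18.6 pp. 124–125] -/
def CMConjugationIsogeny : Prop :=
  ∀ (g : ℕ) (δ : Fin g → ℕ), 0 < g → IsPolarizationType δ →
    ∀ (ι : Type) [Fintype ι] [DecidableEq ι] (K : ι → Type) [∀ i, Field (K i)]
    [∀ i, NumberField (K i)] [∀ i, IsCMField (K i)] (c : CMStructure g δ ι K) (J : C0pm δ) (Φ : ∀ i, CMType (K i)),
    c.IsSpecial J Φ → ∀ (E : IntermediateField ℚ ℂ) [FiniteDimensional ℚ ↥E], (∀ i, traceField (Φ i) ≤ E) →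
    haveI : NumberField ↥E := NumberField.mk
    ∀ (σ : ℂ ≃ₐ[↥E] ℂ) (s : (FiniteAdeleRing (𝓞 ↥E) ↥E)ˣ),
      UnitaryCanonicalModel.IsArtinCorrespondent ↥E (algebraMap ↥E ℂ) s σ.toRingEquiv →
      ∀ r : gspFinAdelic δ,
        ((r : GL (Fin g ⊕ Fin g) (FiniteAdeleRing (𝓞 ℚ) ℚ)) :
            Matrix (Fin g ⊕ Fin g) (Fin g ⊕ Fin g) (FiniteAdeleRing (𝓞 ℚ) ℚ)) = c.cmRecipMatrix Φ E s →
        ∀ a : gspFinAdelic δ,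
          ∃ (A A' : AbelianVariety ℂ) (m : SiegelAdelicMarking J a A) (m' : SiegelAdelicMarking J (r * a) A')
            (f : A.conjugate (σ.restrictScalars ℚ).toRingEquiv ⟶ A'),
            ∀ v w : Fin g ⊕ Fin g → ℚ,
              AdelicCongr ((1 * a⁻¹ : gspFinAdelic δ) : GL (Fin g ⊕ Fin g) finAdeleQ)
                  (((r * a)⁻¹ : gspFinAdelic δ) : GL (Fin g ⊕ Fin g) finAdeleQ) v w →
                AlgPoints.map f.hom.hom.hom (A.conjPoints (σ.restrictScalars ℚ).toRingEquiv (m.r v)) = m'.r w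

/-! ### Head (kernel-checked; nothing asserted) -/

/-- A composite of homomorphisms acts as the composite on points (★ `AbelianVariety.map_hom_comp`, restated to keep the
import cone of this workfile minimal). [cite: MumfordAV1970, §4] -/
private theorem map_hom_comp' {k : Type} [Field k] {A B C : AbelianVariety k} {L : Type} [Field L] [Algebra k L]
    (u : A ⟶ B) (v : B ⟶ C) (P : A.Points L) :
    AlgPoints.map (u ≫ v).hom.hom.hom P = AlgPoints.map v.hom.hom.hom (AlgPoints.map u.hom.hom.hom P) :=
  AlgPoints.map_comp_apply u.hom.hom.hom v.hom.hom.hom P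

/-- **(C∀) the conjugation isogeny for ANY markings** — B-typ04's `iso` input of the M3 head (`slot_isCanonical_of_isModuli'`,
scratch d7266476) closed over `(g, δ)`: the form A-p06's ROUTE ξ′ (CENSUS-M3a e159c28d §2) proves directly.  Not a stub: it FOLLOWS from
(U) + (C) (`cmConjugationIsogenyAll_of`) and IMPLIES (C) (`cmConjugationIsogeny_of_all`), so the M3a prover may close `stub_cmConjugationIsogeny`
either with models of their choice or by proving this ∀-form. [cite: Milne2005ShimuraVarieties, §11 Thm. 11.2 p. 108 and §14 Prop. 14.12 p. 125] -/
def CMConjugationIsogenyAll : Prop :=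
  ∀ (g : ℕ) (δ : Fin g → ℕ), 0 < g → IsPolarizationType δ →
    ∀ (ι : Type) [Fintype ι] [DecidableEq ι] (K : ι → Type) [∀ i, Field (K i)]
    [∀ i, NumberField (K i)] [∀ i, IsCMField (K i)] (c : CMStructure g δ ι K) (J : C0pm δ) (Φ : ∀ i, CMType (K i)),
    c.IsSpecial J Φ → ∀ (E : IntermediateField ℚ ℂ) [FiniteDimensional ℚ ↥E], (∀ i, traceField (Φ i) ≤ E) →
    haveI : NumberField ↥E := NumberField.mk
    ∀ (σ : ℂ ≃ₐ[↥E] ℂ) (s : (FiniteAdeleRing (𝓞 ↥E) ↥E)ˣ),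
      UnitaryCanonicalModel.IsArtinCorrespondent ↥E (algebraMap ↥E ℂ) s σ.toRingEquiv →
      ∀ r : gspFinAdelic δ,
        ((r : GL (Fin g ⊕ Fin g) (FiniteAdeleRing (𝓞 ℚ) ℚ)) :
            Matrix (Fin g ⊕ Fin g) (Fin g ⊕ Fin g) (FiniteAdeleRing (𝓞 ℚ) ℚ)) = c.cmRecipMatrix Φ E s →
        ∀ (a : gspFinAdelic δ) (A A' : AbelianVariety ℂ) (m : SiegelAdelicMarking J a A)
          (m' : SiegelAdelicMarking J (r * a) A'),
          ∃ f : A.conjugate (σ.restrictScalars ℚ).toRingEquiv ⟶ A',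
            ∀ v w : Fin g ⊕ Fin g → ℚ,
              AdelicCongr ((1 * a⁻¹ : gspFinAdelic δ) : GL (Fin g ⊕ Fin g) finAdeleQ)
                  (((r * a)⁻¹ : gspFinAdelic δ) : GL (Fin g ⊕ Fin g) finAdeleQ) v w →
                AlgPoints.map f.hom.hom.hom (A.conjPoints (σ.restrictScalars ℚ).toRingEquiv (m.r v)) = m'.r w

/-- **(U) + (C) ⇒ (C∀)**: transport the models of (C) along the homomorphisms of (U) on both sides, `f := e^σ ≫ f₀ ≫ e′`, using
naturality ★ `conjPoints_map` (`(e x)^σ = e^σ(x^σ)`). [cite: Milne2005ShimuraVarieties, §11 p. 108 and §14 Prop. 14.12 p. 125] -/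
theorem cmConjugationIsogenyAll_of (hU : MarkingTransport) (hC : CMConjugationIsogeny) : CMConjugationIsogenyAll := by
  intro g δ hg hδ ι _ _ K _ _ _ c J Φ hsp E _ hE σ s hs r hr a A A' m m'
  obtain ⟨A₀, A₀', m₀, m₀', f₀, hf₀⟩ := hC g δ hg hδ ι K c J Φ hsp E hE σ s hs r hr a
  obtain ⟨e, he⟩ := hU g δ J a A A₀ m m₀
  obtain ⟨e', he'⟩ := hU g δ J (r * a) A₀' A' m₀' m'
  refine ⟨AbelianVariety.Hom.conjugate (σ.restrictScalars ℚ).toRingEquiv e ≫ f₀ ≫ e', fun v w hvw => ?_⟩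
  rw [map_hom_comp', map_hom_comp', ← AbelianVariety.conjPoints_map, he, hf₀ v w hvw, he']

/-- **(C∀) ⇒ (C)**: markings exist at every point (★-to-be `exists_isLatticeBasis`, `SiegelAdelicMarking.exists`), so the ∀-form gives the
∃-form with those models. [cite: Milne2005ShimuraVarieties, §6 Thm. 6.11 p. 74] -/
theorem cmConjugationIsogeny_of_all (h : CMConjugationIsogenyAll) : CMConjugationIsogeny := by
  intro g δ hg hδ ι _ _ K _ _ _ c J Φ hsp E _ hE σ s hs r hr a
  obtain ⟨γ, hγ⟩ := exists_isLatticeBasis a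
  obtain ⟨A, ⟨m⟩⟩ := SiegelAdelicMarking.exists J a γ hγ
  obtain ⟨γ', hγ'⟩ := exists_isLatticeBasis (r * a)
  obtain ⟨A', ⟨m'⟩⟩ := SiegelAdelicMarking.exists J (r * a) γ' hγ'
  obtain ⟨f, hf⟩ := h g δ hg hδ ι K c J Φ hsp E hE σ s hs r hr a A A' m m'
  exact ⟨A, A', m, m', f, hf⟩

variable {g : ℕ} {δ : Fin g → ℕ} {Sg : SiegelComplexRecordSystem g δ}

/-- **M3 = M3b ∘ M3a: a moduli model on points satisfies Shimura reciprocity at CM points** ([MilISV] Prop. 14.12 «If this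
map commutes with the action of `Aut(ℂ/E_G)` then `M(G,X)` is canonical»), from (C∀) and the existence of markings at every point
(★-to-be `exists_isLatticeBasis`, `SiegelAdelicMarking.exists`, B-typ04 T1′ package): B-typ04's slot `slot_isCanonical_of_isModuli'`
re-homed verbatim. [cite: Milne2005ShimuraVarieties, §14 Prop. 14.12 p. 125] -/
theorem isCanonical_of_isModuli (hg : 0 < g) (hδ : IsPolarizationType δ) (hAll : CMConjugationIsogenyAll)
    (R : SiegelRationalModel g δ Sg) (h : R.IsModuli) : R.IsCanonical := by
  intro ι _ _ K _ _ _ c J Φ hsp E _ hE σ s hs r hr L a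
  obtain ⟨γ, hγ⟩ := exists_isLatticeBasis a
  obtain ⟨A, ⟨m⟩⟩ := SiegelAdelicMarking.exists J a γ hγ
  obtain ⟨γ', hγ'⟩ := exists_isLatticeBasis (r * a)
  obtain ⟨A', ⟨m'⟩⟩ := SiegelAdelicMarking.exists J (r * a) γ' hγ'
  obtain ⟨f, hf⟩ := hAll g δ hg hδ ι K c J Φ hsp E hE σ s hs r hr a A A' m m'
  exact h L (σ.restrictScalars ℚ) J J a (r * a) A A' m m' f ⟨1, L.1.one_mem, hf⟩

/-- **#60 `SiegelS1` DERIVED from Mumford's moduli model (M1′) and the two provable stubs** — the books' CLOSED-BY-DERIVATION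
of row I-7: the witness `(Sg, R)` is Mumford's, `IsCanonical` is `isCanonical_of_isModuli`, `HasIntegralHecke` is carried by M1′.
[cite: Deligne1971TravauxShimura, Thm. 4.21 p. 152] [cite: Milne2005ShimuraVarieties, §14 Prop. 14.12 p. 125] -/
theorem siegelS1_of_mumford (hM : deligne1971_siegelModuliOnPoints) (hU : MarkingTransport) (hC : CMConjugationIsogeny) : SiegelS1 := by
  intro g δ hg hδ
  obtain ⟨Sg, R, hmod, hH⟩ := hM g δ hg hδ
  exact ⟨Sg, R, isCanonical_of_isModuli hg hδ (cmConjugationIsogenyAll_of hU hC) R hmod, hH⟩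

/-- **#60 `SiegelS1` DERIVED from M1′ and the ∀-form (C∀) directly** (bypassing (U) and (C): B-p09's J-M3a-δ FULL certificate
30850fdd proves `CMConjugationIsogenyAll` from ★ Thm. 18.6 and (β) `CompletedSandwich` alone).
[cite: Deligne1971TravauxShimura, Thm. 4.21 p. 152] [cite: Milne2005ShimuraVarieties, §14 Prop. 14.12 p. 125] -/
theorem siegelS1_of_cmConjugationIsogenyAll (hM : deligne1971_siegelModuliOnPoints) (hAll : CMConjugationIsogenyAll) : SiegelS1 := by
  intro g δ hg hδ
  obtain ⟨Sg, R, hmod, hH⟩ := hM g δ hg hδ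
  exact ⟨Sg, R, isCanonical_of_isModuli hg hδ hAll R hmod, hH⟩

/-! ### §2. SECOND LAYER UNDER (C): the two work orders of ROUTE ξ′ — texts = B-p09 (J-M3a-δ) junction v2 c83b085d7b9887e5 VERBATIM
(`B-provers/B-p09/SlotTest-M3a-routeXi-assembly.v2.B-p09g5.lean` :767 (α), :791 (β), :928 (α∀), :946 glue; kernel-green there with the
head `RouteXi.cmConjugationIsogenyAll_of (h186 : shimura1998_thm18_6) (hα : CMAdaptedMarkingsAll) (hβ : CompletedSandwich) : CMConjugationIsogenyAll`,
`h186` discharged Summits-side by ★ `Theorems.shimura1998_thm18_6_holds`).  Homed HERE so that the (α)/(β) closers and B-p09's assembly theorem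
state them BY NAME (REF1 (N5) logic one layer down); nothing asserted. -/

section SecondLayer

open Function
open scoped nonZeroDivisors
open Literature.NumberTheory.ComplexMultiplication (CMTypeUniformization reflexNormFiniteIdele ideleMulIdealUnits)
open Literature.NumberTheory.NumberFields.IdeleAction (ideleMulEquiv)
open Literature.NumberTheory.Adeles (latticeOfGL)

/-- **(α) CM-ADAPTED MARKINGS WITH TORUS MAPS (M3a-α, census §5; A-p06 ★-to-be R60-47 `exists_hom_map_cover_eq` core + B-p11
(PΛ) R60-33c `chart_ratCast_mem_pi_idealLattice_iff` + B-p01 marking homs; ★-filed R60-51 `SiegelCMTorusMapsOfChart`).**  At a CM special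
pair `(c, J, Φ)` THERE IS a cyclic vector `v₀` (`q x = act(x)·v₀` bijective — take the one of ★ R60-33 `IsSpecial.exists_periodIso` (c), to
which the period isomorphism `e` is adapted) such that EVERY point `[J, b]` has a marked model `(A, m)` — the prover's CHOICE (e.g.
`Ψ := e ∘ γ`, so that `(ℝ^{2g}, J)/Λ_b = ∏ᵢ ℂ^{Φᵢ}/Ψ(q⁻¹Λ_b)`) — admitting
(down) for every principal structure `ξ₁` of type `(Kᵢ, Φᵢ, 𝔞₁)` with `prᵢ(q⁻¹Λ_b) ⊆ 𝔞₁` a homomorphism `χ : A ⟶ A₁` with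
`χ(u(q x)) = ξ₁.r(xᵢ)` (induced by the projection `prᵢ : ∏ ℂ^{Φ} → ℂ^{Φᵢ}`), and
(up) for every `M : ℕ` and every principal structure `ξ₁` of type `(Kᵢ, Φᵢ, 𝔞₁)` with `q(eᵢ(M·𝔞₁)) ⊆ Λ_b` a homomorphism
`θ : A₁ ⟶ A` with `θ(ξ₁.r y) = u(q(eᵢ(M y)))` (induced by `z ↦ inclᵢ(M z)`).  GAGA for tori ★ `exists_hom_of_mdifferentiable_complexTorus`.
[cite: LangeBirkenhake1992, Ch. 1 Prop. 1.2.1 and Ch. 2 Cor. 2.1.17] [cite: Deligne1971TravauxShimura, 4.18 p. 150]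
[cite: Milne2005ShimuraVarieties, Ex. 12.4 (b) p. 112 and §6 Thm. 6.11 p. 74] -/
def CMAdaptedMarkings : Prop :=
  ∀ (g : ℕ) (δ : Fin g → ℕ) (ι : Type) [Fintype ι] [DecidableEq ι] (K : ι → Type) [∀ i, Field (K i)]
    [∀ i, NumberField (K i)] [∀ i, IsCMField (K i)] (c : CMStructure g δ ι K) (J : C0pm δ) (Φ : ∀ i, CMType (K i)),
    c.IsSpecial J Φ → ∃ v₀ : Fin g ⊕ Fin g → ℚ, (Bijective fun x : Π i, K i => c.act x v₀) ∧
    ∀ b : gspFinAdelic δ,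
      ∃ (A : AbelianVariety ℂ) (m : SiegelAdelicMarking J b A),
        (∀ (i : ι) (𝔞₁ : (FractionalIdeal (𝓞 (K i))⁰ (K i))ˣ) (A₁ : AbelianVariety ℂ) (ι₁ : 𝓞 (K i) →+* End A₁)
            (ξ₁ : CMTypeUniformization (Φ i) 𝔞₁ A₁ ι₁),
            (∀ x : Π i, K i, c.act x v₀ ∈ latticeOfGL (b : GL (Fin g ⊕ Fin g) finAdeleQ) →
                x i ∈ (𝔞₁ : FractionalIdeal (𝓞 (K i))⁰ (K i))) →
              ∃ χ : A ⟶ A₁, ∀ x : Π i, K i, AlgPoints.map χ.hom.hom.hom (m.r (c.act x v₀)) = ξ₁.r (x i)) ∧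
        (∀ (i : ι) (M : ℕ) (𝔞₁ : (FractionalIdeal (𝓞 (K i))⁰ (K i))ˣ) (A₁ : AbelianVariety ℂ) (ι₁ : 𝓞 (K i) →+* End A₁)
            (ξ₁ : CMTypeUniformization (Φ i) 𝔞₁ A₁ ι₁),
            (∀ y : K i, y ∈ (𝔞₁ : FractionalIdeal (𝓞 (K i))⁰ (K i)) →
                c.act (Pi.single i (M • y)) v₀ ∈ latticeOfGL (b : GL (Fin g ⊕ Fin g) finAdeleQ)) →
              ∃ θ : A₁ ⟶ A, ∀ y : K i, AlgPoints.map θ.hom.hom.hom (ξ₁.r y) = m.r (c.act (Pi.single i (M • y)) v₀))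

/-- **(β) THE COMPLETED SANDWICH at a reciprocity translate (M3a-β, census §4 (L5)/§5; B-p13 R60-48 + B-p01 ★ R60-43 +
★ R60-40a `exists_fractionalIdeal_sandwich` + ★ R60-14c; plus (β0) «`q⁻¹Λ_a` is a full lattice of `F`»).**  For a CM structure `c`
with cyclic vector `v₀`, `E ⊇ E*(Φᵢ)`, a finite idèle `s` of `E`, `r` with matrix `R((N_{E,Φᵢ}(s))ᵢ) = c.cmRecipMatrix Φ E s` and any
`a`: there are non-zero fractional ideals `𝔟ᵢ` and `M ≥ 1` with (β↓) `prᵢ(q⁻¹Λ_a) ⊆ 𝔟ᵢ`, (β↑) `q(eᵢ(M·Nᵢ𝔟ᵢ)) ⊆ Λ_{ra}`, and (β≡) the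
clause form «`Nᵢ·(xᵢ mod 𝔟ᵢ) = yᵢ mod Nᵢ𝔟ᵢ` for every `i` ⇒ `a⁻¹·q(M x)^ ≡ (ra)⁻¹·q(M y)^ (mod ẑ^{2g})`» — i.e. `M·N·⊕𝔟̂ᵢ ⊆ Λ̂_{ra}`
(`Λ̂_{ra} = N·Λ̂_a ⊇ N·M·⊕𝔟̂ᵢ`). [cite: Shimura1998, §18.3 (18.3a) p. 122; §6.2 proof of Thm. 3 pp. 42–44]
[cite: Milne2005ShimuraVarieties, Def. 12.8 (60)–(62) p. 114; §4 pp. 48–49] -/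
def CompletedSandwich : Prop :=
  ∀ (g : ℕ) (δ : Fin g → ℕ) (ι : Type) [Fintype ι] [DecidableEq ι] (K : ι → Type) [∀ i, Field (K i)]
    [∀ i, NumberField (K i)] [∀ i, IsCMField (K i)] (c : CMStructure g δ ι K) (Φ : ∀ i, CMType (K i))
    (v₀ : Fin g ⊕ Fin g → ℚ), (Bijective fun x : Π i, K i => c.act x v₀) →
    ∀ (E : IntermediateField ℚ ℂ) [NumberField ↥E] (s : (FiniteAdeleRing (𝓞 ↥E) ↥E)ˣ) (r : gspFinAdelic δ),
      ((r : GL (Fin g ⊕ Fin g) (FiniteAdeleRing (𝓞 ℚ) ℚ)) :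
          Matrix (Fin g ⊕ Fin g) (Fin g ⊕ Fin g) (FiniteAdeleRing (𝓞 ℚ) ℚ)) = c.cmRecipMatrix Φ E s →
      ∀ a : gspFinAdelic δ,
        ∃ (𝔟 : ∀ i, (FractionalIdeal (𝓞 (K i))⁰ (K i))ˣ) (M : ℕ), M ≠ 0 ∧
          (∀ x : Π i, K i, c.act x v₀ ∈ latticeOfGL (a : GL (Fin g ⊕ Fin g) finAdeleQ) →
              ∀ i, x i ∈ (𝔟 i : FractionalIdeal (𝓞 (K i))⁰ (K i))) ∧
          (∀ (i : ι) (y : K i), y ∈ (ideleMulIdealUnits (reflexNormFiniteIdele (K i) (Φ i) E s) (𝔟 i) :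
              FractionalIdeal (𝓞 (K i))⁰ (K i)) →
            c.act (Pi.single i (M • y)) v₀ ∈ latticeOfGL ((r * a : gspFinAdelic δ) : GL (Fin g ⊕ Fin g) finAdeleQ)) ∧
          (∀ x y : Π i, K i,
            (∀ i, ideleMulEquiv (reflexNormFiniteIdele (K i) (Φ i) E s) (𝔟 i : FractionalIdeal (𝓞 (K i))⁰ (K i))
                (𝔟 i).ne_zero (Submodule.Quotient.mk (x i)) = Submodule.Quotient.mk (y i)) →
              AdelicCongr ((1 * a⁻¹ : gspFinAdelic δ) : GL (Fin g ⊕ Fin g) finAdeleQ)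
                (((r * a)⁻¹ : gspFinAdelic δ) : GL (Fin g ⊕ Fin g) finAdeleQ) (c.act (M • x) v₀) (c.act (M • y) v₀))

/-- **(α∀) CM TORUS MAPS FOR EVERY MARKING (A-p06's hetero junction M3a-α in full: arbitrary chart `Ψ`)** — the same two clauses
as (α), but for EVERY marked model `(A, m)` of `[J, b]` rather than a chosen one.  Follows from (α) + (U) (`cmAdaptedMarkingsAll_of`).
[cite: LangeBirkenhake1992, Ch. 1 Prop. 1.2.1 and Ch. 2 Cor. 2.1.17] [cite: Deligne1971TravauxShimura, 4.18 p. 150] -/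
def CMAdaptedMarkingsAll : Prop :=
  ∀ (g : ℕ) (δ : Fin g → ℕ) (ι : Type) [Fintype ι] [DecidableEq ι] (K : ι → Type) [∀ i, Field (K i)]
    [∀ i, NumberField (K i)] [∀ i, IsCMField (K i)] (c : CMStructure g δ ι K) (J : C0pm δ) (Φ : ∀ i, CMType (K i)),
    c.IsSpecial J Φ → ∃ v₀ : Fin g ⊕ Fin g → ℚ, (Bijective fun x : Π i, K i => c.act x v₀) ∧
    ∀ (b : gspFinAdelic δ) (A : AbelianVariety ℂ) (m : SiegelAdelicMarking J b A),
        (∀ (i : ι) (𝔞₁ : (FractionalIdeal (𝓞 (K i))⁰ (K i))ˣ) (A₁ : AbelianVariety ℂ) (ι₁ : 𝓞 (K i) →+* End A₁)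
            (ξ₁ : CMTypeUniformization (Φ i) 𝔞₁ A₁ ι₁),
            (∀ x : Π i, K i, c.act x v₀ ∈ latticeOfGL (b : GL (Fin g ⊕ Fin g) finAdeleQ) →
                x i ∈ (𝔞₁ : FractionalIdeal (𝓞 (K i))⁰ (K i))) →
              ∃ χ : A ⟶ A₁, ∀ x : Π i, K i, AlgPoints.map χ.hom.hom.hom (m.r (c.act x v₀)) = ξ₁.r (x i)) ∧
        (∀ (i : ι) (M : ℕ) (𝔞₁ : (FractionalIdeal (𝓞 (K i))⁰ (K i))ˣ) (A₁ : AbelianVariety ℂ) (ι₁ : 𝓞 (K i) →+* End A₁)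
            (ξ₁ : CMTypeUniformization (Φ i) 𝔞₁ A₁ ι₁),
            (∀ y : K i, y ∈ (𝔞₁ : FractionalIdeal (𝓞 (K i))⁰ (K i)) →
                c.act (Pi.single i (M • y)) v₀ ∈ latticeOfGL (b : GL (Fin g ⊕ Fin g) finAdeleQ)) →
              ∃ θ : A₁ ⟶ A, ∀ y : K i, AlgPoints.map θ.hom.hom.hom (ξ₁.r y) = m.r (c.act (Pi.single i (M • y)) v₀))

/-- **(α) + (U) ⇒ (α∀)**: compose the torus maps of the chosen model with the marking transports `A ⟶ A_chosen`, `A_chosen ⟶ A`.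
[cite: Milne2005ShimuraVarieties, §6 Thm. 6.11 p. 74] -/
theorem cmAdaptedMarkingsAll_of (hU : MarkingTransport) (hα : CMAdaptedMarkings) : CMAdaptedMarkingsAll := by
  intro g δ ι _ _ K _ _ _ c J Φ hsp
  obtain ⟨v₀, hv₀, hαv⟩ := hα g δ ι K c J Φ hsp
  refine ⟨v₀, hv₀, fun b A m => ?_⟩
  obtain ⟨A₀, m₀, hdown, hup⟩ := hαv b
  obtain ⟨e, he⟩ := hU g δ J b A A₀ m m₀
  obtain ⟨e', he'⟩ := hU g δ J b A₀ A m₀ m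
  refine ⟨fun i 𝔞₁ A₁ ι₁ ξ₁ hlat => ?_, fun i M 𝔞₁ A₁ ι₁ ξ₁ hlat => ?_⟩
  · obtain ⟨χ, hχ⟩ := hdown i 𝔞₁ A₁ ι₁ ξ₁ hlat
    exact ⟨e ≫ χ, fun x => by rw [map_hom_comp', he, hχ]⟩
  · obtain ⟨θ, hθ⟩ := hup i M 𝔞₁ A₁ ι₁ ξ₁ hlat
    exact ⟨θ ≫ e', fun y => by rw [map_hom_comp', hθ, he']⟩

end SecondLayer

end Summit.HodgeConjecture.CorCM.HypDel.MumfordModuli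

end
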